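/-
Copyright: the b2b-balaban cell (near-miss cell 7), T⁴-continuum fan-out; row NE7b ROUND-2 swarm, seat
t4-ne7b-formalise-leaf-05 gen 3 (row S6g′ INSTANCE of `t4/b2b-balaban-t4-ne7b-p1/LEAVES-NE7b.md`, owner's rulings
R-OWNER-22-23∕-24: T3a part 3 «laws», file A).  Released under the licence of the surrounding project.
-/
import Summits.QuantumFields.BalabanUV.T4Continuum.Support.HistoryJoinsSupEnd
import Summits.QuantumFields.BalabanUV.T4Continuum.Support.HistoryJoinsTemplates
import Summits.QuantumFields.BalabanUV.T4Continuum.Support.HistoryJoinsTag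
import Summits.QuantumFields.BalabanUV.T4Continuum.Support.HistoryZoneMassCluster

/-!
# The CONCRETE zone of the count for placements carrying region templates, and its cheap laws
# (row S6g′ INSTANCE, T3a part 3 «laws», file A «ZONE»)

Summits-side support leaf of the T⁴-continuum cell (rung (B)+1 on a FINITE torus only; NOT infinite volume, NOT the
mass gap, NOT the Clay statement; NOT a proof of the spine estimate NE7b).  Row NE7b, route «COUNT», row S6g′.
[folklore] definitions + bookkeeping over the lineage's own carriers (gen 2's `addrTag`, leaf-07 gen 2's levelled
region reading `HistoryZones.regZoneD`, leaf-10 gen 4's `HistoryJoinsTemplates.Template`); nothing is quoted from print,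
nothing printed is asserted, no `[cite:]` tag, no `Prop` fact minted (`OK` is a decidable side-condition PREDICATE with
parameters on OUR placements, not a fact).

WHAT.  For a shape tree `Z : Gen PEv` and a placement `p : Addr D → TCell d (n·L^K) × Template d M` (anchor cell, region
template per birth address):
* `anchorZ` (the level block of a cell as a point of `ℤ^d`), **`regOf c₀ p`** (the region map of the address-TAGGED tree:
  the template at address `a` translated to the anchor's block, reduced on the level torus — leaf-07 gen 2's
  `redZone`), **`OK c₀ p Z`** (every placed template has `card ≤ tcap d fat` and every anchor cell has the scale of its
  birth's level, the root's cell included), **`zoneP c c₀ t Z p`** = leaf-07∕04's `regZoneD Prod.snd n L K lv c (regOf c₀ p)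
  t (addrTag [] Z)` when `OK ∧ lv t ≤ K`, `∅` otherwise;
* §2 the laws that need no mass law: **`hzoneW_zoneP`** (the END's side facts: level `≤ K`, root cell of its scale,
  blocks in range), **`hlawT_zoneP`** (the root-template law: a non-empty zone forces
  `tsz (root template) ≤ 4·2^d·(fat (root) + 1)`), `zoneP_renew` (renewal-blind), `regOf_inRange`, `regOf_linked`
  (reduced translated templates are in range and `1`-linked), `regOf_card_le` (`#regOf ≤ tcap d fat` under `OK`).
File B (`HistoryJoinsPlacedLaws`) discharges the cardinality and cyclic-distance laws from leaf-04 g3's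
`card_regZoneD_le_pieces`∕`linked_regZoneD_pieces` through `HistoryZoneMassBridge.hconn_of_cadm` + gen 2's
`cadm_addrTag`∕`zone_part_eq_zf`.

HONEST SCOPE.  Definitions and bookkeeping over OUR carriers; nothing of H3∕(B)∕BetaPertH touched; `BirthShapeNodup`
NOT retired here; NE7b NOT proved.  HONEST DEPENDENCY (cell): continuum YM on T⁴ ⇐ BetaPertH ∧ nine spine estimates
(0/9 proved); BetaPertH ⇐ (D1) ∧ (D4) ∧ CAP+tail; G-an2-4 gates asym, D1 and NE2/3/4.  This file changes none of it.
-/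

open Finset
open Literature.MathematicalPhysics.QuantumFieldTheory.Balaban1983to89
open Literature.MathematicalPhysics.QuantumFieldTheory.Balaban1983to89.B13ScaleTransfer (Pt FaceConnected)
open T4PersistenceDictionary T4PartnerMultiplicity T4BranchingRecordsGas
open Summit.QuantumFields.BalabanUV.T4Continuum.PlacementSkeleton
open Summit.QuantumFields.BalabanUV.T4Continuum.ZoneTorus
open Summit.QuantumFields.BalabanUV.T4Continuum.HistoryZones
open Summit.QuantumFields.BalabanUV.T4Continuum.HistoryZoneMass
open Summit.QuantumFields.BalabanUV.T4Continuum.HistoryJoins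
open Summit.QuantumFields.BalabanUV.T4Continuum.HistoryJoinsAdm
open Summit.QuantumFields.BalabanUV.T4Continuum.HistoryJoinsTag
open Summit.QuantumFields.BalabanUV.T4Continuum.HistoryJoinsSupTorus
open Summit.QuantumFields.BalabanUV.T4Continuum.HistoryJoinsSup
open Summit.QuantumFields.BalabanUV.T4Continuum.HistoryRegionTemplates
open Summit.QuantumFields.BalabanUV.T4Continuum.HistoryJoinsTemplates

namespace Summit.QuantumFields.BalabanUV.T4Continuum.HistoryJoinsPlacedZone

noncomputable section

open scoped Classical

variable {d n L K D M : ℕ} (lv : ℕ → ℕ)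

/-! ## §1 The region map of a placement and the zone -/

/-- the level-`lv s` block of a cell, as a point of `ℤ^d` [folklore] -/
def anchorZ (L : ℕ) (lv : ℕ → ℕ) {N : ℕ} (y : TCell d N) (s : ℕ) : Pt d := fun i => ((blk L (lv s) y i : ℕ) : ℤ)

variable (n L K) in
/-- **THE REGION MAP OF A PLACEMENT** on the address-tagged tree: the template placed at address `a` translated to the
anchor's block of the birth's level, reduced on the level torus. [folklore] -/
def regOf (c₀ : TCell d (n * L ^ K) × Template d M) (p : Addr D → TCell d (n * L ^ K) × Template d M)
    (ab : List Bool × PEv) : Finset (Fin d → ℕ) :=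
  redZone (n * L ^ (K - lv ab.2.step))
    (translate (evalA c₀ p ab.1).2 (anchorZ L lv (evalA c₀ p ab.1).1 ab.2.step))

variable (n L K) in
/-- **THE SIDE CONDITIONS OF A PLACEMENT**: every placed template is small for its birth's fatness, every anchor cell
has the scale of its birth's level, and so has the root's cell for the root step. [folklore] -/
def OK (c₀ : TCell d (n * L ^ K) × Template d M) (p : Addr D → TCell d (n * L ^ K) × Template d M) (Z : Gen PEv) :
    Prop :=
  (∀ ab ∈ births (addrTag [] Z),
      (evalA c₀ p ab.1).2.1.card ≤ tcap d ab.2.fat ∧ IsScale L (lv ab.2.step) (evalA c₀ p ab.1).1) ∧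
    IsScale L (lv Z.rootStep) (evalA c₀ p (rootAddr Z)).1

variable (n L K) in
/-- **THE COUNT's ZONE FOR PLACEMENTS CARRYING TEMPLATES**: the levelled region reading of the address-tagged tree under
the placement's region map, at levels `lv t ≤ K` and for `OK` placements; empty otherwise. [folklore] -/
def zoneP (c : ℕ) (c₀ : TCell d (n * L ^ K) × Template d M) (t : ℕ) (Z : Gen PEv)
    (p : Addr D → TCell d (n * L ^ K) × Template d M) : Finset (Fin d → ℕ) :=
  if OK n L K lv c₀ p Z ∧ lv t ≤ K then regZoneD Prod.snd n L K lv c (regOf n L K lv c₀ p) t (addrTag [] Z) else ∅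

variable {lv}
variable {c : ℕ} {c₀ : TCell d (n * L ^ K) × Template d M} {p : Addr D → TCell d (n * L ^ K) × Template d M}

/-- membership unfolds the guard [folklore] -/
theorem mem_zoneP {t : ℕ} {Z : Gen PEv} {u : Fin d → ℕ} (hu : u ∈ zoneP n L K lv c c₀ t Z p) :
    OK n L K lv c₀ p Z ∧ lv t ≤ K ∧ u ∈ regZoneD Prod.snd n L K lv c (regOf n L K lv c₀ p) t (addrTag [] Z) := by
  unfold zoneP at hu
  split_ifs at hu with h
  · exact ⟨h.1, h.2, hu⟩
  · simp at hu

/-- under the guard the zone IS the region reading [folklore] -/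
theorem zoneP_eq_of_ok {t : ℕ} {Z : Gen PEv} (hok : OK n L K lv c₀ p Z) (ht : lv t ≤ K) :
    zoneP n L K lv c c₀ t Z p = regZoneD Prod.snd n L K lv c (regOf n L K lv c₀ p) t (addrTag [] Z) := by
  simp [zoneP, hok, ht]

/-- a non-empty zone forces the guard [folklore] -/
theorem ok_of_nonempty {t : ℕ} {Z : Gen PEv} (h : (zoneP n L K lv c c₀ t Z p).Nonempty) :
    OK n L K lv c₀ p Z ∧ lv t ≤ K := by
  obtain ⟨u, hu⟩ := h
  exact ⟨(mem_zoneP hu).1, (mem_zoneP hu).2.1⟩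

/-- **THE ZONE IS RENEWAL-BLIND.** [folklore] -/
theorem zoneP_renew (t : ℕ) (Z : Gen PEv) (e : PEv) (h : ℕ) :
    zoneP n L K lv c c₀ t (Gen.renew Z e h) p = zoneP n L K lv c c₀ t Z p := by
  have hOK : OK n L K lv c₀ p (Gen.renew Z e h) ↔ OK n L K lv c₀ p Z := by
    simp only [OK, addrTag_renew, births_renew, Gen.rootStep_renew, rootAddr]
  unfold zoneP
  rw [addrTag_renew, regZoneD_renew]
  simp only [hOK]

/-! ## §2 The region map: range, linkedness, cardinality -/

/-- reduced regions are in range [folklore] -/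
theorem regOf_inRange (hL : 1 ≤ L) (hn : 1 ≤ n) (ab : List Bool × PEv) :
    InRange (n * L ^ (K - lv ab.2.step)) (regOf n L K lv c₀ p ab) :=
  inRange_redZone (by positivity) _

/-- reduced translated templates are `1`-linked (face-connected before reduction) [folklore] -/
theorem regOf_linked (hL : 1 ≤ L) (hn : 1 ≤ n) (ab : List Bool × PEv) :
    Linked (n * L ^ (K - lv ab.2.step)) 1 (regOf n L K lv c₀ p ab) :=
  linked_redZone (by positivity) (faceConnected_translate _ _)

/-- the reduced region has at most as many cells as the template [folklore] -/
theorem regOf_card_le (ab : List Bool × PEv) : (regOf n L K lv c₀ p ab).card ≤ (evalA c₀ p ab.1).2.1.card := by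
  unfold regOf redZone
  exact card_image_le.trans (by rw [card_translate])

/-- under `OK`, a birth's region has `≤ tcap d fat` cells [folklore] -/
theorem regOf_card_le_tcap {Z : Gen PEv} (hok : OK n L K lv c₀ p Z) {ab : List Bool × PEv}
    (hab : ab ∈ births (addrTag [] Z)) : (regOf n L K lv c₀ p ab).card ≤ tcap d ab.2.fat :=
  (regOf_card_le ab).trans (hok.1 ab hab).1

/-- `tcap d f ≤ 4·2^d·(f + 1)` in `ℝ` [folklore] -/
theorem tcap_le_real (d f : ℕ) : (tcap d f : ℝ) ≤ 4 * 2 ^ d * ((f : ℝ) + 1) := by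
  unfold tcap; push_cast; nlinarith [pow_pos (show (0:ℝ) < 2 by norm_num) d]

/-! ## §3 The END's side facts and the root-template law -/

/-- the root's tagged label is a birth of the tagged tree [folklore] -/
theorem root_mem_births_addrTag (Z : Gen PEv) : (rootAddr Z, Z.root) ∈ births (addrTag [] Z) := by
  have h := root_mem_births (addrTag [] Z)
  rwa [root_addrTag, List.nil_append] at h

/-- **THE END's SIDE FACTS `hzoneW` FOR `zoneP`**: a block of the zone of an (admissibly) placed structure lies at a level
`≤ K`, the root cell has the scale of the root step, and the block is in range. [folklore] -/
theorem hzoneW_zoneP (t : ℕ) (Z : Gen PEv) (q : Addr D → TCell d (n * L ^ K) × Template d M) (u : Fin d → ℕ)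
    (hu : u ∈ zoneP n L K lv c c₀ t Z q) :
    lv t ≤ K ∧ IsScale L (lv Z.rootStep) (evalA c₀ q (rootAddr Z)).1 ∧ ∀ i, u i < n * L ^ (K - lv t) := by
  obtain ⟨hok, ht, hu'⟩ := mem_zoneP hu
  exact ⟨ht, hok.2, fun i => inRange_regZoneD (sh := Prod.snd) n L K lv c _ t _ u hu' i⟩

/-- **THE ROOT-TEMPLATE LAW FOR `zoneP`**: a non-empty zone forces the root's template to have
`card ≤ 4·2^d·(fat (root) + 1)` (`κT = 4·2^d`). [folklore] -/
theorem hlawT_zoneP {t : ℕ} {Z : Gen PEv} {q : Addr D → TCell d (n * L ^ K) × Template d M}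
    (h : (zoneP n L K lv c c₀ t Z q).Nonempty) :
    ((evalA c₀ q (rootAddr Z)).2.1.card : ℝ) ≤ 4 * 2 ^ d * (((Z.root.fat : ℕ) : ℝ) + 1) := by
  obtain ⟨hok, -⟩ := ok_of_nonempty h
  have h1 := (hok.1 _ (root_mem_births_addrTag Z)).1
  exact le_trans (by exact_mod_cast h1) (tcap_le_real d _)

end

end Summit.QuantumFields.BalabanUV.T4Continuum.HistoryJoinsPlacedZone
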